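import Summits.QuantumFields.YangMills.Theorems.IR.TypFormatRecursionStep
import HarnessLib

/-!
# The Dobrushin–Shlosman block recursion WITH RARE BAD CELLS — the decay (typical-class currency)

Helper module for item `stmt-QuantumFields-19354` (crux `IR` of route `BalabanLadder`, sub-problem `YangMills`; lane B
«strong coupling after blocking»; `--supports`, it closes nothing).

`recursion_decay_typical` iterates `recursion_step_typical` (`Theorems/IR/TypFormatRecursionStep.lean`) from the trivial
bound `1`: under the finite-size condition with rare bad cells (hFS at window `n`, threshold `ε`, goodness on the
non-resampled cells of the radius-`(2n+1)` cube; hRare: a resampled cell is bad with kernel-probability `≤ δ₂` once its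
off-volume neighbours are good) and `ε·M ≤ 1`, `M = (4n+3)ᵈ − (4n+1)ᵈ`, the single-cell boundary influence at agreement
radius `j(2n+1)` and goodness radius `j(2n+1)+1` is `≤ (ε M)^j + j·(2+3ε)·M·δ₂` for EVERY cell-union volume (the
recursion `δ_{j+1} = εM·δ_j + (2+3ε)·M·δ₂`, `δ₀ = 1`, bounded using `εM ≤ 1`).  The Typ twin of the tree's
`FiniteSizeCriterion.recursion_decay` (`(ε M)^j`, no bad cells).

HONEST FRAMING: an abstract lemma about range-one specifications; no statement about Yang–Mills mixing, no gap, not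
Clay.  No `sorry`; axioms ⊆ {propext, Classical.choice, Quot.sound}.

## References

* R. L. Dobrushin, S. B. Shlosman, *Constructive criterion for the uniqueness of Gibbs field* (1985), §2.
* L. Bertini, E. N. M. Cirillo, E. Olivieri, Commun. Math. Phys. 261 (2006) (graded expansions with sparse bad blocks).
-/

noncomputable section

open MeasureTheory
open Literature.Probability.LatticeModels
open Literature.MathematicalPhysics.QuantumLattice

namespace Summit.QuantumFields.YangMills.Theorems.FiniteSizeCriterion

variable {d : ℕ} {S : Type*} [MeasurableSpace S]

/-- **Decay of the single-cell boundary influence from the finite-size condition with rare bad cells**: under the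
hypotheses of `recursion_step_typical` and `ε·M ≤ 1`, for every `j`, every cell-union volume `Λ`, every cell `x` and
every `[0,1]`-valued measurable observable `g` of the cell `x`, two exteriors that agree at the edges off `Λ` within cell
distance `j(2n+1)` of `x` and are GOOD on every cell off `Λ` within cell distance `j(2n+1)+1` of `x` give
`γ_Λ`-expectations of `g` within `(ε M)^j + j·(2+3ε)·M·δ₂`, `M = (4n+3)ᵈ − (4n+1)ᵈ` (induction on `j` from the trivial
bound `1`: `δ_{j+1} = εM·δ_j + (2+3ε)Mδ₂`). -/
theorem recursion_decay_typical {γ : Specification (ZdEdge d) S} (hγ : IsSpecification γ)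
    (hloc : ∀ (Λ : Finset (ZdEdge d)) (f : (ZdEdge d → S) → ℝ) (T : Finset (ZdEdge d)),
      Measurable f → DependsOn f ↑T →
        DependsOn (fun η => ∫ σ, f σ ∂(γ Λ η)) ↑(T ∪ (plaquettesTouching Λ).biUnion plaquetteEdges))
    {cell : ZdEdge d → (Fin d → ℤ)}
    (hC1 : ∀ e e' : ZdEdge d, (∀ k, e'.1 k - 1 ≤ e.1 k ∧ e.1 k ≤ e'.1 k + 1) →
      ∀ k, |cell e k - cell e' k| ≤ 1)
    (hfin : ∀ y : Fin d → ℤ, Set.Finite {v : ZdEdge d | cell v = y})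
    {Good : (Fin d → ℤ) → Set (ZdEdge d → S)} (hGoodm : ∀ c, MeasurableSet (Good c))
    (hGooddep : ∀ c, DependsOn (fun σ : ZdEdge d → S => σ ∈ Good c) {v | cell v = c})
    {n : ℕ} {ε : ℝ} (hε : 0 ≤ ε)
    (hεM : ε * (((2 * (2 * n + 1) + 1) ^ d - (2 * (2 * n) + 1) ^ d : ℕ) : ℝ) ≤ 1)
    (hFS : ∀ (x : Fin d → ℤ) (Λ₀ : Finset (ZdEdge d)),
      (∀ v w, cell v = cell w → v ∈ Λ₀ → w ∈ Λ₀) →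
      (∀ v ∈ Λ₀, ∀ i, |cell v i - x i| ≤ 2 * n) → (∀ v, cell v = x → v ∈ Λ₀) →
      ∀ η η' : ZdEdge d → S, (∀ v, (∀ i, |cell v i - x i| ≤ 2 * n) → η v = η' v) →
      (∀ c : Fin d → ℤ, (∀ i, |c i - x i| ≤ 2 * n + 1) → ∀ v, cell v = c → v ∉ Λ₀ →
        η ∈ Good c ∧ η' ∈ Good c) →
      ∀ f : (ZdEdge d → S) → ℝ, DependsOn f {v | cell v = x} → Measurable f →
        (∀ σ, 0 ≤ f σ ∧ f σ ≤ 1) → |∫ σ, f σ ∂(γ Λ₀ η) - ∫ σ, f σ ∂(γ Λ₀ η')| ≤ ε)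
    {δ₂ : ℝ} (hδ₂ : 0 ≤ δ₂)
    (hRare : ∀ (Λ : Finset (ZdEdge d)), (∀ v w, cell v = cell w → v ∈ Λ → w ∈ Λ) →
      ∀ (y : Fin d → ℤ), (∃ v ∈ Λ, cell v = y) →
      ∀ ζ : ZdEdge d → S, (∀ c : Fin d → ℤ, (∀ i, |c i - y i| ≤ 1) → ∀ v, cell v = c → v ∉ Λ → ζ ∈ Good c) →
        (γ Λ ζ).real {σ | σ ∉ Good y} ≤ δ₂)
    (j : ℕ) (Λ : Finset (ZdEdge d)) (hΛ : ∀ v w, cell v = cell w → v ∈ Λ → w ∈ Λ)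
    (x : Fin d → ℤ) (g : (ZdEdge d → S) → ℝ) (hgm : Measurable g) (hg01 : ∀ σ, 0 ≤ g σ ∧ g σ ≤ 1)
    (hgdep : DependsOn g {v | cell v = x}) (ζ ζ' : ZdEdge d → S)
    (hagree : ∀ v, v ∉ Λ → (∀ i, |cell v i - x i| ≤ j * (2 * n + 1)) → ζ v = ζ' v)
    (hgood : ∀ c : Fin d → ℤ, (∀ i, |c i - x i| ≤ j * (2 * n + 1) + 1) → ∀ v, cell v = c → v ∉ Λ →
      ζ ∈ Good c ∧ ζ' ∈ Good c) :
    |∫ σ, g σ ∂(γ Λ ζ) - ∫ σ, g σ ∂(γ Λ ζ')| ≤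
      (ε * (((2 * (2 * n + 1) + 1) ^ d - (2 * (2 * n) + 1) ^ d : ℕ) : ℝ)) ^ j +
        j * ((2 + 3 * ε) * (((2 * (2 * n + 1) + 1) ^ d - (2 * (2 * n) + 1) ^ d : ℕ) : ℝ) * δ₂) := by
  set M : ℝ := (((2 * (2 * n + 1) + 1) ^ d - (2 * (2 * n) + 1) ^ d : ℕ) : ℝ) with hM
  have hM0 : 0 ≤ M := Nat.cast_nonneg _
  have hK0 : 0 ≤ (2 + 3 * ε) * M * δ₂ := by positivity
  induction j generalizing Λ x g ζ ζ' with
  | zero =>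
    haveI := hγ.isProbability Λ ζ
    haveI := hγ.isProbability Λ ζ'
    have h1 := integral_mem_unitInterval (μ := γ Λ ζ) hgm hg01
    have h2 := integral_mem_unitInterval (μ := γ Λ ζ') hgm hg01
    rw [pow_zero, Nat.cast_zero, zero_mul, add_zero, abs_le]
    constructor <;> linarith [h1.1, h1.2, h2.1, h2.2]
  | succ j ih =>
    have hδj : 0 ≤ (ε * M) ^ j + j * ((2 + 3 * ε) * M * δ₂) := by positivity
    have h := recursion_step_typical hγ hloc hC1 hfin hGoodm hGooddep hε hFS hδ₂ hRare hδj
      (fun Λ' hΛ' x' g' hg'm hg'01 hg'dep η η' hag hgd => ih Λ' hΛ' x' g' hg'm hg'01 hg'dep η η' hag hgd)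
      Λ hΛ x g hgm hg01 hgdep ζ ζ' (by exact_mod_cast hagree) (by exact_mod_cast hgood)
    refine h.trans ?_
    rw [← hM]
    -- `εM·(δ_j + δ₂) + 2(1+ε)Mδ₂ = (εM)^{j+1} + εM·(j K) + K ≤ (εM)^{j+1} + (j+1) K` since `εM ≤ 1`
    have hj0 : (0 : ℝ) ≤ j := Nat.cast_nonneg _
    have hjK : ε * M * ((j : ℝ) * ((2 + 3 * ε) * M * δ₂)) ≤ 1 * ((j : ℝ) * ((2 + 3 * ε) * M * δ₂)) :=
      mul_le_mul_of_nonneg_right hεM (mul_nonneg hj0 hK0)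
    have e : ε * M * ((ε * M) ^ j + (j : ℝ) * ((2 + 3 * ε) * M * δ₂) + δ₂) + 2 * (1 + ε) * M * δ₂ =
        (ε * M) ^ (j + 1) + ε * M * ((j : ℝ) * ((2 + 3 * ε) * M * δ₂)) + (2 + 3 * ε) * M * δ₂ := by ring
    rw [e]
    push_cast
    linarith

/-- **Decay with the `j`-free bad-cell term** (geometric sum): under the hypotheses of `recursion_decay_typical` and `ε·M < 1`, the
single-cell influence at agreement radius `j(2n+1)` and goodness radius `j(2n+1)+1` is `≤ (ε M)^j + (2+3ε)·M·δ₂ / (1 − ε M)`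
(induction on `j` with the invariant bound `θ^j + K/(1−θ)`, `θ = εM`, `K = (2+3ε)Mδ₂`: `θ·(θ^j + K/(1−θ)) + K = θ^{j+1} + K/(1−θ)`). -/
theorem recursion_decay_typical_geom {γ : Specification (ZdEdge d) S} (hγ : IsSpecification γ)
    (hloc : ∀ (Λ : Finset (ZdEdge d)) (f : (ZdEdge d → S) → ℝ) (T : Finset (ZdEdge d)),
      Measurable f → DependsOn f ↑T →
        DependsOn (fun η => ∫ σ, f σ ∂(γ Λ η)) ↑(T ∪ (plaquettesTouching Λ).biUnion plaquetteEdges))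
    {cell : ZdEdge d → (Fin d → ℤ)}
    (hC1 : ∀ e e' : ZdEdge d, (∀ k, e'.1 k - 1 ≤ e.1 k ∧ e.1 k ≤ e'.1 k + 1) →
      ∀ k, |cell e k - cell e' k| ≤ 1)
    (hfin : ∀ y : Fin d → ℤ, Set.Finite {v : ZdEdge d | cell v = y})
    {Good : (Fin d → ℤ) → Set (ZdEdge d → S)} (hGoodm : ∀ c, MeasurableSet (Good c))
    (hGooddep : ∀ c, DependsOn (fun σ : ZdEdge d → S => σ ∈ Good c) {v | cell v = c})
    {n : ℕ} {ε : ℝ} (hε : 0 ≤ ε)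
    (hεM : ε * (((2 * (2 * n + 1) + 1) ^ d - (2 * (2 * n) + 1) ^ d : ℕ) : ℝ) < 1)
    (hFS : ∀ (x : Fin d → ℤ) (Λ₀ : Finset (ZdEdge d)),
      (∀ v w, cell v = cell w → v ∈ Λ₀ → w ∈ Λ₀) →
      (∀ v ∈ Λ₀, ∀ i, |cell v i - x i| ≤ 2 * n) → (∀ v, cell v = x → v ∈ Λ₀) →
      ∀ η η' : ZdEdge d → S, (∀ v, (∀ i, |cell v i - x i| ≤ 2 * n) → η v = η' v) →
      (∀ c : Fin d → ℤ, (∀ i, |c i - x i| ≤ 2 * n + 1) → ∀ v, cell v = c → v ∉ Λ₀ →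
        η ∈ Good c ∧ η' ∈ Good c) →
      ∀ f : (ZdEdge d → S) → ℝ, DependsOn f {v | cell v = x} → Measurable f →
        (∀ σ, 0 ≤ f σ ∧ f σ ≤ 1) → |∫ σ, f σ ∂(γ Λ₀ η) - ∫ σ, f σ ∂(γ Λ₀ η')| ≤ ε)
    {δ₂ : ℝ} (hδ₂ : 0 ≤ δ₂)
    (hRare : ∀ (Λ : Finset (ZdEdge d)), (∀ v w, cell v = cell w → v ∈ Λ → w ∈ Λ) →
      ∀ (y : Fin d → ℤ), (∃ v ∈ Λ, cell v = y) →
      ∀ ζ : ZdEdge d → S, (∀ c : Fin d → ℤ, (∀ i, |c i - y i| ≤ 1) → ∀ v, cell v = c → v ∉ Λ → ζ ∈ Good c) →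
        (γ Λ ζ).real {σ | σ ∉ Good y} ≤ δ₂)
    (j : ℕ) (Λ : Finset (ZdEdge d)) (hΛ : ∀ v w, cell v = cell w → v ∈ Λ → w ∈ Λ)
    (x : Fin d → ℤ) (g : (ZdEdge d → S) → ℝ) (hgm : Measurable g) (hg01 : ∀ σ, 0 ≤ g σ ∧ g σ ≤ 1)
    (hgdep : DependsOn g {v | cell v = x}) (ζ ζ' : ZdEdge d → S)
    (hagree : ∀ v, v ∉ Λ → (∀ i, |cell v i - x i| ≤ j * (2 * n + 1)) → ζ v = ζ' v)
    (hgood : ∀ c : Fin d → ℤ, (∀ i, |c i - x i| ≤ j * (2 * n + 1) + 1) → ∀ v, cell v = c → v ∉ Λ →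
      ζ ∈ Good c ∧ ζ' ∈ Good c) :
    |∫ σ, g σ ∂(γ Λ ζ) - ∫ σ, g σ ∂(γ Λ ζ')| ≤
      (ε * (((2 * (2 * n + 1) + 1) ^ d - (2 * (2 * n) + 1) ^ d : ℕ) : ℝ)) ^ j +
        (2 + 3 * ε) * (((2 * (2 * n + 1) + 1) ^ d - (2 * (2 * n) + 1) ^ d : ℕ) : ℝ) * δ₂ /
          (1 - ε * (((2 * (2 * n + 1) + 1) ^ d - (2 * (2 * n) + 1) ^ d : ℕ) : ℝ)) := by
  set M : ℝ := (((2 * (2 * n + 1) + 1) ^ d - (2 * (2 * n) + 1) ^ d : ℕ) : ℝ) with hM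
  have hM0 : 0 ≤ M := Nat.cast_nonneg _
  have hK0 : 0 ≤ (2 + 3 * ε) * M * δ₂ := by positivity
  have h1θ : 0 < 1 - ε * M := by linarith
  have hR0 : 0 ≤ (2 + 3 * ε) * M * δ₂ / (1 - ε * M) := div_nonneg hK0 h1θ.le
  induction j generalizing Λ x g ζ ζ' with
  | zero =>
    haveI := hγ.isProbability Λ ζ
    haveI := hγ.isProbability Λ ζ'
    have h1 := integral_mem_unitInterval (μ := γ Λ ζ) hgm hg01
    have h2 := integral_mem_unitInterval (μ := γ Λ ζ') hgm hg01
    rw [pow_zero, abs_le]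
    constructor <;> linarith [h1.1, h1.2, h2.1, h2.2]
  | succ j ih =>
    have hδj : 0 ≤ (ε * M) ^ j + (2 + 3 * ε) * M * δ₂ / (1 - ε * M) := by positivity
    have h := recursion_step_typical hγ hloc hC1 hfin hGoodm hGooddep hε hFS hδ₂ hRare hδj
      (fun Λ' hΛ' x' g' hg'm hg'01 hg'dep η η' hag hgd => ih Λ' hΛ' x' g' hg'm hg'01 hg'dep η η' hag hgd)
      Λ hΛ x g hgm hg01 hgdep ζ ζ' (by exact_mod_cast hagree) (by exact_mod_cast hgood)
    refine h.trans ?_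
    rw [← hM]
    -- `εM·(θ^j + K/(1−θ) + δ₂) + 2(1+ε)Mδ₂ = θ^{j+1} + εM·K/(1−θ) + K = θ^{j+1} + K/(1−θ)`
    have e1 : ε * M * ((ε * M) ^ j + (2 + 3 * ε) * M * δ₂ / (1 - ε * M) + δ₂) + 2 * (1 + ε) * M * δ₂ =
        (ε * M) ^ (j + 1) + (ε * M * ((2 + 3 * ε) * M * δ₂ / (1 - ε * M)) + (2 + 3 * ε) * M * δ₂) := by ring
    have e2 : ε * M * ((2 + 3 * ε) * M * δ₂ / (1 - ε * M)) + (2 + 3 * ε) * M * δ₂ =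
        (2 + 3 * ε) * M * δ₂ / (1 - ε * M) := by
      field_simp
      ring
    rw [e1, e2]

end Summit.QuantumFields.YangMills.Theorems.FiniteSizeCriterion

end
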